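import Literature.AnabelianGeometry.EtaleTheta.Discharge.Sec5EnvelopeTopologyClosures

/-!
# [EtTh] §5 ↔ §2 dictionary of Lemma 5.9 (iv): what the hypotheses `ThetaSectionCompat` and
# `CyclotomicCharacterCompatX` REDUCE to (PROOF-ONLY)

Mochizuki, *The étale theta function and its Frobenioid-theoretic manifestations*, Publ. RIMS **45**
(2009) [cite: MochizukiEtTh2009, Prop 5.2 (iii) p.98 (PRIMS p.324); Lem 5.8 proof p.105 (PRIMS p.331);
Lem 5.9 (iii)/(iv) p.106 (PRIMS p.332)].  abc-iut cell, block F, seat abc-iut-f-116 (tranche 116);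
PROOF-ONLY companion (0 `def`) of abc-iut-L2-t11's `Discharge/Sec5EnvelopeTopology.lean`, sequel of
`Sec5EnvelopeTopologyClosures.lean` (where the universal closures of the rows are refuted).

The two named dictionary hypotheses of the tranche that have NO unconditional producer in the tree are
here reduced, for ANY §5 datum `𝔉`, to their honest residual content:

* **F-0521 `ThetaSectionCompat`** (Prop. 5.2 (iii) in abc-iut-L2-t2's coordinates: "the Kummer class
  determined by the bi-Kummer `N`-th root … corresponds precisely to the reduction modulo `N` of the class
  `η̲̈^Θ`", p.98): since `ι` carries `Π^tp_Ÿ̲` bijectively onto `Π^tp_Ÿ`, the dictionary DETERMINES the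
  cocycle — `existsUnique_thetaSectionCompat`: there is EXACTLY ONE `η : Π^tp_Ÿ → μ_N` with
  `ThetaSectionCompat H T ι m hYdd η`, namely the transport `η_𝔉 := k ↦ m(s^⊔-gp_N · s^⊓-gp_N⁻¹(ι⁻¹ k))⁻¹`
  of the bi-Kummer difference cocycle (`thetaSectionCompat_iff`); so for the consumers
  (`envIsoBiTheta_of`, `…_canonical`, `…_birat`), which take `η ∈ T.thetaCocycles` AND the dictionary,
  the dictionary is free and the residual hypothesis is exactly "`η_𝔉 ∈ T.thetaCocycles`" — the
  printed content of Prop. 5.2 (iii) (`exists_thetaSectionCompat_mem_iff`); also `η(1) = 1` for any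
  admissible `η` (`ThetaSectionCompat.apply_one`).
* **F-1306 `CyclotomicCharacterCompatX`** (print, Lemma 5.8 proof p.105: "the set of elements on which
  `Π^tp_Y` [i.e., `G_K`, via the natural surjection `Π^tp_Y ↠ G_K`] acts via multiplication by an element
  of `μ_N(B_N)`" — the printed sentence concerns `Π^tp_Y`; the row is the STRONGER `Π^tp_X̲`-form of the
  cyclotomic-character dictionary, needed on all of `Π^tp_X̲` for the outer `l·ℤ`-action of Lemma 5.9
  (iii); docstring corrected per RQ7 note N1 of abc-iut-aud-18 on p430571, declarations unchanged): both
  sides of the dictionary are multiplicative in `g`, so the set of `g ∈ Π^tp_X̲` at which it holds is a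
  subgroup; hence — `cyclotomicCharacterCompatX_iff` — the `Π^tp_X̲`-dictionary is EQUIVALENT to
  abc-iut-L2-t4's `Π^tp_Y̲`-dictionary `CyclotomicCharacterCompat` (F-1307) TOGETHER WITH the dictionary
  at any ONE lift `g₀` of the generator of `Π^tp_X̲/Π^tp_Y̲ ≅ l·ℤ` ("`l·ℤ ⥲ Π^tp_X/Π^tp_Y`", Lemma 5.9
  (iii)); the extra conjunct is not redundant (`exists_cyclotomicCharacterCompat_not_compatX`).
HONEST FRAMING: structural facts about the typed interfaces; nothing of [EtTh] is asserted; typed ≠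
proved; no side is taken on [IUTchIII] Cor. 3.12.
-/

namespace Literature.AnabelianGeometry.EtaleTheta

open CategoryTheory

universe w v v' u u'

namespace ThetaFrobenioid

variable {C : Type u} [Category.{v} C] {D : Type u'} [Category.{v'} D] (𝔉 : ThetaFrobenioid.{w} C D)

/-! ### F-0521: the Prop. 5.2 (iii) dictionary determines the cocycle -/

section ThetaSection

variable (H : 𝔉.Facts) (T : ThetaEnvData.{v} 𝔉.N) (ι : 𝔉.PiX ≃* T.PiX)
  (m : 𝔉.muTorsion 𝔉.BN 𝔉.N ≃* T.mu) (hYdd : 𝔉.IdentifiesPiYdd T ι)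

/-- Under `IdentifiesPiYdd`, `ι⁻¹` carries `Π^tp_Ÿ` into `Π^tp_Ÿ̲`. [cite: MochizukiEtTh2009, Lem 5.9 (iv) p.106 (PRIMS p.332)] -/
theorem IdentifiesPiYdd.symm_mem {T : ThetaEnvData.{v} 𝔉.N} {ι : 𝔉.PiX ≃* T.PiX}
    (hYdd : 𝔉.IdentifiesPiYdd T ι) (k : T.PiYdd) : ι.symm (k : T.PiX) ∈ 𝔉.PiYdd :=
  (hYdd _).mpr (by rw [MulEquiv.apply_symm_apply]; exact k.2)

/-- **The dictionary in solved form**: `ThetaSectionCompat … η` says exactly that `η` IS the transport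
`k ↦ m(s^⊔-gp_N(ρ ι⁻¹k) · s^⊓-gp_N(ρ ι⁻¹k)⁻¹)⁻¹` of the bi-Kummer difference cocycle.
[cite: MochizukiEtTh2009, Prop 5.2 (iii) p.98 (PRIMS p.324)] -/
theorem thetaSectionCompat_iff (η : T.PiYdd → T.mu) :
    𝔉.ThetaSectionCompat H T ι m hYdd η ↔
      ∀ k : T.PiYdd, η k = (m (𝔉.diffCocycle H ⟨ι.symm (k : T.PiX), hYdd.symm_mem 𝔉 k⟩))⁻¹ := by
  constructor
  · intro h k
    have e : (⟨ι ((⟨ι.symm (k : T.PiX), hYdd.symm_mem 𝔉 k⟩ : 𝔉.PiYdd) : 𝔉.PiX),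
        (hYdd _).mp (hYdd.symm_mem 𝔉 k)⟩ : T.PiYdd) = k :=
      Subtype.ext (ι.apply_symm_apply _)
    have hk := h ⟨ι.symm (k : T.PiX), hYdd.symm_mem 𝔉 k⟩
    rw [e] at hk
    rw [hk, inv_inv]
  · intro h y
    have e : (⟨ι.symm ((⟨ι (y : 𝔉.PiX), (hYdd _).mp y.2⟩ : T.PiYdd) : T.PiX),
        hYdd.symm_mem 𝔉 _⟩ : 𝔉.PiYdd) = y :=
      Subtype.ext (ι.symm_apply_apply _)
    rw [h ⟨ι (y : 𝔉.PiX), (hYdd _).mp y.2⟩, inv_inv, e]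

/-- **F-0521, structural**: the Prop. 5.2 (iii) dictionary is satisfied by EXACTLY ONE cocycle
`η : Π^tp_Ÿ → μ_N` — it is a hypothesis that DETERMINES `η` (so, for consumers taking `η ∈ T.thetaCocycles`
and the dictionary, the residual content is the membership of that `η` in the class `η̈^Θ`).
[cite: MochizukiEtTh2009, Prop 5.2 (iii) p.98 (PRIMS p.324)] -/
theorem existsUnique_thetaSectionCompat :
    ∃! η : T.PiYdd → T.mu, 𝔉.ThetaSectionCompat H T ι m hYdd η := by
  refine ⟨fun k => (m (𝔉.diffCocycle H ⟨ι.symm (k : T.PiX), hYdd.symm_mem 𝔉 k⟩))⁻¹,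
    (𝔉.thetaSectionCompat_iff H T ι m hYdd _).mpr fun _ => rfl, fun η hη => ?_⟩
  funext k
  exact (𝔉.thetaSectionCompat_iff H T ι m hYdd η).mp hη k

/-- Two cocycles satisfying the dictionary are equal. [cite: MochizukiEtTh2009, Prop 5.2 (iii) p.98 (PRIMS p.324)] -/
theorem ThetaSectionCompat.unique {H : 𝔉.Facts} {T : ThetaEnvData.{v} 𝔉.N} {ι : 𝔉.PiX ≃* T.PiX}
    {m : 𝔉.muTorsion 𝔉.BN 𝔉.N ≃* T.mu} {hYdd : 𝔉.IdentifiesPiYdd T ι} {η η' : T.PiYdd → T.mu}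
    (h : 𝔉.ThetaSectionCompat H T ι m hYdd η) (h' : 𝔉.ThetaSectionCompat H T ι m hYdd η') : η = η' :=
  (𝔉.existsUnique_thetaSectionCompat H T ι m hYdd).unique h h'

/-- Any cocycle satisfying the dictionary vanishes at `1` (the difference cocycle does, `diffCocycle_one`).
[cite: MochizukiEtTh2009, Prop 5.2 (iii) p.98 (PRIMS p.324)] -/
theorem ThetaSectionCompat.apply_one {H : 𝔉.Facts} {T : ThetaEnvData.{v} 𝔉.N} {ι : 𝔉.PiX ≃* T.PiX}
    {m : 𝔉.muTorsion 𝔉.BN 𝔉.N ≃* T.mu} {hYdd : 𝔉.IdentifiesPiYdd T ι} {η : T.PiYdd → T.mu}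
    (h : 𝔉.ThetaSectionCompat H T ι m hYdd η) : η 1 = 1 := by
  have e : (⟨ι ((1 : 𝔉.PiYdd) : 𝔉.PiX), (hYdd _).mp (1 : 𝔉.PiYdd).2⟩ : T.PiYdd) = 1 :=
    Subtype.ext (by simp)
  have h1 := h 1
  rw [𝔉.diffCocycle_one H, map_one, e] at h1
  exact inv_eq_one.mp h1.symm

/-- **The residual of F-0521 for the consumers**: "there is a cocycle OF THE CLASS satisfying the
dictionary" (the joint hypothesis `η ∈ T.thetaCocycles ∧ ThetaSectionCompat … η` of `envIsoBiTheta_of` /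
`…_canonical` / `…_birat`) holds iff the transported bi-Kummer difference cocycle lies in the class `η̈^Θ`
— the printed content of Prop. 5.2 (iii).  [cite: MochizukiEtTh2009, Prop 5.2 (iii) p.98 (PRIMS p.324)] -/
theorem exists_thetaSectionCompat_mem_iff :
    (∃ η ∈ T.thetaCocycles, 𝔉.ThetaSectionCompat H T ι m hYdd η) ↔
      (fun k : T.PiYdd => (m (𝔉.diffCocycle H ⟨ι.symm (k : T.PiX), hYdd.symm_mem 𝔉 k⟩))⁻¹) ∈
        T.thetaCocycles := by
  constructor
  · rintro ⟨η, hη, h⟩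
    have : η = fun k : T.PiYdd => (m (𝔉.diffCocycle H ⟨ι.symm (k : T.PiX), hYdd.symm_mem 𝔉 k⟩))⁻¹ :=
      funext ((𝔉.thetaSectionCompat_iff H T ι m hYdd η).mp h)
    rw [← this]
    exact hη
  · intro hmem
    exact ⟨_, hmem, (𝔉.thetaSectionCompat_iff H T ι m hYdd _).mpr fun _ => rfl⟩

end ThetaSection

/-! ### F-1306: the `Π^tp_X̲`-dictionary = the `Π^tp_Y̲`-dictionary + one generator of `l·ℤ` -/

section Cyclotomic

variable (T : ThetaEnvData.{v} 𝔉.N) (ι : 𝔉.PiX ≃* T.PiX) (m : 𝔉.muTorsion 𝔉.BN 𝔉.N ≃* T.mu)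

/-- **F-1306 ⇔ F-1307 ∧ (one generator)**: the cyclotomic-character dictionary on all of `Π^tp_X̲` holds
iff it holds on `Π^tp_Y̲ = Ker(Π^tp_X̲ ↠ l·ℤ)` (abc-iut-L2-t4's `CyclotomicCharacterCompat`) and at one
element `g₀` generating `Π^tp_X̲/Π^tp_Y̲ ≅ l·ℤ` ("`l·ℤ ⥲ Π^tp_X/Π^tp_Y`", Lemma 5.9 (iii)): the set of
`g` at which conjugation by `s^⊓-gp_N(ρ g)` on `μ_N(B_N)` matches `χ(aug(ι g))` under `m` is a subgroup.
[cite: MochizukiEtTh2009, Lem 5.8 proof p.105 (PRIMS p.331); Lem 5.9 (iii) p.106 (PRIMS p.332)] -/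
theorem cyclotomicCharacterCompatX_iff (g₀ : 𝔉.PiX) (hg₀ : 𝔉.zquot g₀ = Multiplicative.ofAdd 1) :
    𝔉.CyclotomicCharacterCompatX T ι m ↔
      𝔉.CyclotomicCharacterCompat T ι m ∧
        ∀ u u' : 𝔉.muTorsion 𝔉.BN 𝔉.N,
          (u' : Aut 𝔉.BN) = 𝔉.sgpCap (𝔉.ρ g₀) * u * (𝔉.sgpCap (𝔉.ρ g₀))⁻¹ →
            m u' = T.chi (T.aug (ι g₀)) (m u) := by
  refine ⟨fun h => ⟨h.toY, h g₀⟩, fun ⟨hY, h₀⟩ => ?_⟩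
  -- the elements of `Π^tp_X̲` at which the dictionary holds form a subgroup `S`
  haveI := 𝔉.muTorsion_normal 𝔉.BN 𝔉.N
  let S : Subgroup 𝔉.PiX :=
    { carrier := {g | ∀ u u' : 𝔉.muTorsion 𝔉.BN 𝔉.N,
        (u' : Aut 𝔉.BN) = 𝔉.sgpCap (𝔉.ρ g) * u * (𝔉.sgpCap (𝔉.ρ g))⁻¹ →
          m u' = T.chi (T.aug (ι g)) (m u)}
      one_mem' := by
        intro u u' hu'
        rw [map_one, map_one, one_mul, inv_one, mul_one] at hu'
        rw [Subtype.ext hu', map_one, map_one, map_one, MulAut.one_apply]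
      mul_mem' := by
        intro a b ha hb u u' hu'
        let u'' : 𝔉.muTorsion 𝔉.BN 𝔉.N :=
          ⟨𝔉.sgpCap (𝔉.ρ b) * u * (𝔉.sgpCap (𝔉.ρ b))⁻¹,
            (𝔉.muTorsion_normal 𝔉.BN 𝔉.N).conj_mem _ u.2 _⟩
        have hb' : m u'' = T.chi (T.aug (ι b)) (m u) := hb u u'' rfl
        have ha' : m u' = T.chi (T.aug (ι a)) (m u'') := ha u'' u' (by
          rw [hu', map_mul, map_mul, mul_inv_rev]
          change _ = 𝔉.sgpCap (𝔉.ρ a) * (𝔉.sgpCap (𝔉.ρ b) * u * (𝔉.sgpCap (𝔉.ρ b))⁻¹) * _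
          group)
        rw [ha', hb', map_mul, map_mul, map_mul, MulAut.mul_apply]
      inv_mem' := by
        intro a ha u u' hu'
        have hu : (u : Aut 𝔉.BN) = 𝔉.sgpCap (𝔉.ρ a) * u' * (𝔉.sgpCap (𝔉.ρ a))⁻¹ := by
          rw [hu', map_inv, map_inv, inv_inv]
          group
        have ha' : m u = T.chi (T.aug (ι a)) (m u') := ha u' u hu
        rw [map_inv, map_inv, map_inv, ha', MulAut.inv_apply, MulEquiv.symm_apply_apply] }
  have hS : S = ⊤ := by
    rw [eq_top_iff]
    intro g _
    -- `g = (g · g₀^{-n}) · g₀^n` with `n := zquot g` and `g · g₀^{-n} ∈ Π^tp_Y̲ ⊆ S`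
    have hy : g * (g₀ ^ (Multiplicative.toAdd (𝔉.zquot g)))⁻¹ ∈ 𝔉.PiY := by
      rw [ThetaFrobenioid.PiY, MonoidHom.mem_ker, map_mul, map_inv, map_zpow, hg₀, ← ofAdd_zsmul,
        smul_eq_mul, mul_one, ofAdd_toAdd, mul_inv_cancel]
    have hg : g = g * (g₀ ^ (Multiplicative.toAdd (𝔉.zquot g)))⁻¹ *
        g₀ ^ (Multiplicative.toAdd (𝔉.zquot g)) := by rw [inv_mul_cancel_right]
    rw [hg]
    exact S.mul_mem (hY _ hy) (S.zpow_mem h₀ _)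
  intro g
  have hg : g ∈ S := by rw [hS]; exact Subgroup.mem_top g
  exact hg

end Cyclotomic

end ThetaFrobenioid

end Literature.AnabelianGeometry.EtaleTheta
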